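import Literature.Analysis.FluidPDE.MVWeakStrongUniqueness
import Literature.Analysis.FluidPDE.MVRelativeEnergyPointwise
import Literature.Analysis.FunctionSpaces.TorusChainRule
import Literature.Analysis.FunctionSpaces.TorusMollifierEstimates
import HarnessLib

/-!
# Point data of a classical Euler solution: continuity and momentum equations in point form

For a classical solution `(ρ, u, ϑ)` of the complete Euler system on `[0,T₁) × 𝕋³`
(`CompressibleEuler.IsClassicalEulerSolution`, conservative form (1.1)–(1.3) of
Březina–Feireisl 2018) we package its values and first derivatives at a point into the
`StrongPointData` of `MVRelativeEnergyPointwise.lean` (`classicalPointData`) and derive the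
pointwise relations consumed by the relative-energy inequality:

* `IsClassicalEulerSolution.massEq_pointData` — `∂ₜr + U·∇r + r divU = 0` (product rule in (1.1));
* `IsClassicalEulerSolution.momentumEq_pointData` — the convective form
  `r(∂ₜU + (U·∇)U) + ∇p(r,Θ) = 0` of (1.2) (using (1.1) and the chain rule
  `∇[p(r,Θ)] = p_ρ ∇r + p_ϑ ∇Θ`).

The temperature equation is derived in `ClassicalEulerTemperature.lean`.

## References

* J. Březina, E. Feireisl, J. Math. Soc. Japan 70 (2018), (1.1)–(1.3), (3.2).
-/

noncomputable section

open Set Filter Function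
open scoped Topology BigOperators InnerProductSpace

namespace Literature.Analysis.FluidPDE

namespace CompressibleEuler

open Literature.Analysis.FunctionSpaces Literature.Analysis.FunctionSpaces.Torus StrongPointData

/-- The values and first derivatives at `(t, x)` of the fields `(ρ, u, ϑ)`, time derivatives
taken within the time set `S` (for solutions on `[0,T₁)`, `S = Ico 0 T₁`):
`gU i j = ∂ⱼuᵢ`. [cite: BrezinaFeireisl2018, (3.2)] -/
def classicalPointData (S : Set ℝ) (ρ : ℝ → UnitAddTorus (Fin 3) → ℝ)
    (u : ℝ → UnitAddTorus (Fin 3) → EuclideanSpace ℝ (Fin 3)) (ϑ : ℝ → UnitAddTorus (Fin 3) → ℝ)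
    (t : ℝ) (x : UnitAddTorus (Fin 3)) : StrongPointData where
  r := ρ t x
  Θ := ϑ t x
  rt := timeDerivWithin S ρ t x
  Θt := timeDerivWithin S ϑ t x
  U := u t x
  Ut := timeDerivWithin S u t x
  gr := Torus.gradient (ρ t) x
  gΘ := Torus.gradient (ϑ t) x
  gU := fun i j => partialDeriv j (fun y => u t y i) x

/-! ## Calculus of space–time fields: products and coordinates -/

section Calculus

variable {d : Type*} [Fintype d] {S : Set ℝ} {t : ℝ}

/-- Leibniz rule for one-sided time derivatives of a scalar times a vector field. [folklore] -/
theorem timeDerivWithin_smul {F : Type*} [NormedAddCommGroup F] [NormedSpace ℝ F]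
    {a : ℝ → UnitAddTorus d → ℝ} {b : ℝ → UnitAddTorus d → F} (ha : IsSmoothSpaceTimeOn S a)
    (hb : IsSmoothSpaceTimeOn S b) (hS : UniqueDiffOn ℝ S) (ht : t ∈ S) (x : UnitAddTorus d) :
    timeDerivWithin S (fun s y => a s y • b s y) t x =
      a t x • timeDerivWithin S b t x + timeDerivWithin S a t x • b t x :=
  ((ha.hasDerivWithinAt_slice ht x).smul (hb.hasDerivWithinAt_slice ht x)).derivWithin (hS t ht)

/-- Leibniz rule for one-sided time derivatives of a product of scalar fields. [folklore] -/
theorem timeDerivWithin_mul {a b : ℝ → UnitAddTorus d → ℝ} (ha : IsSmoothSpaceTimeOn S a)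
    (hb : IsSmoothSpaceTimeOn S b) (hS : UniqueDiffOn ℝ S) (ht : t ∈ S) (x : UnitAddTorus d) :
    timeDerivWithin S (fun s y => a s y * b s y) t x =
      timeDerivWithin S a t x * b t x + a t x * timeDerivWithin S b t x :=
  ((ha.hasDerivWithinAt_slice ht x).fun_mul (hb.hasDerivWithinAt_slice ht x)).derivWithin (hS t ht)

/-- One-sided time derivatives of sums. [folklore] -/
theorem timeDerivWithin_add {F : Type*} [NormedAddCommGroup F] [NormedSpace ℝ F]
    {a b : ℝ → UnitAddTorus d → F} (ha : IsSmoothSpaceTimeOn S a)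
    (hb : IsSmoothSpaceTimeOn S b) (hS : UniqueDiffOn ℝ S) (ht : t ∈ S) (x : UnitAddTorus d) :
    timeDerivWithin S (fun s y => a s y + b s y) t x =
      timeDerivWithin S a t x + timeDerivWithin S b t x :=
  ((ha.hasDerivWithinAt_slice ht x).add (hb.hasDerivWithinAt_slice ht x)).derivWithin (hS t ht)

/-- Coordinates commute with one-sided time derivatives of vector fields. [folklore] -/
theorem timeDerivWithin_apply_coord {b : ℝ → UnitAddTorus d → EuclideanSpace ℝ d}
    (hb : IsSmoothSpaceTimeOn S b) (hS : UniqueDiffOn ℝ S) (ht : t ∈ S) (x : UnitAddTorus d)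
    (i : d) : timeDerivWithin S (fun s y => b s y i) t x = timeDerivWithin S b t x i := by
  have h := (EuclideanSpace.proj i : EuclideanSpace ℝ d →L[ℝ] ℝ).hasFDerivAt.comp_hasDerivWithinAt
    t (hb.hasDerivWithinAt_slice ht x)
  exact h.derivWithin (hS t ht)

/-- The time derivative of `½‖u‖²` is `∑ₖ uₖ ∂ₜuₖ`. [folklore] -/
theorem timeDerivWithin_half_norm_sq {b : ℝ → UnitAddTorus d → EuclideanSpace ℝ d}
    (hb : IsSmoothSpaceTimeOn S b) (hS : UniqueDiffOn ℝ S) (ht : t ∈ S) (x : UnitAddTorus d) :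
    timeDerivWithin S (fun s y => ‖b s y‖ ^ 2 / 2) t x = ∑ k, b t x k * timeDerivWithin S b t x k := by
  have h := ((hb.hasDerivWithinAt_slice ht x).inner ℝ (hb.hasDerivWithinAt_slice ht x)).div_const 2
  have heq : (fun s => ⟪b s x, b s x⟫_ℝ / 2) = fun s => ‖b s x‖ ^ 2 / 2 := by
    funext s; rw [real_inner_self_eq_norm_sq]
  rw [heq] at h
  have hL : timeDerivWithin S (fun s y => ‖b s y‖ ^ 2 / 2) t x =
      derivWithin (fun τ => ‖b τ x‖ ^ 2 / 2) S t := rfl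
  rw [hL, h.derivWithin (hS t ht), real_inner_comm, ← two_mul, mul_div_cancel_left₀ _ two_ne_zero,
    PiLp.inner_apply]
  refine Finset.sum_congr rfl fun k _ => ?_
  simp

variable [DecidableEq d] in
/-- `∂ᵢ(f + g)(x) = ∂ᵢf(x) + ∂ᵢg(x)` (applied, lambda form of `partialDeriv_add`). [folklore] -/
theorem partialDeriv_add_apply {F : Type*} [NormedAddCommGroup F] [NormedSpace ℝ F]
    {f g : UnitAddTorus d → F} (hf : IsContDiff 1 f) (hg : IsContDiff 1 g) (i : d)
    (x : UnitAddTorus d) :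
    partialDeriv i (fun y => f y + g y) x = partialDeriv i f x + partialDeriv i g x := by
  change partialDeriv i (f + g) x = _
  rw [partialDeriv_add hf hg i]
  rfl

variable [DecidableEq d] in
/-- `∂ᵢ(f - g)(x) = ∂ᵢf(x) - ∂ᵢg(x)`. [folklore] -/
theorem partialDeriv_sub_apply {f g : UnitAddTorus d → ℝ} (hf : IsContDiff 1 f)
    (hg : IsContDiff 1 g) (i : d) (x : UnitAddTorus d) :
    partialDeriv i (fun y => f y - g y) x = partialDeriv i f x - partialDeriv i g x := by
  have hfg : IsContDiff 1 (fun y => f y - g y) := ContDiff.sub hf hg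
  have h := partialDeriv_add_apply hfg hg i x
  have e : (fun y => f y - g y + g y) = f := by funext y; simp
  rw [e] at h
  linarith

end Calculus

/-! ## The continuity and momentum equations at a point -/

variable {eos : EulerEOS} {T₁ : ℝ} {ρ : ℝ → UnitAddTorus (Fin 3) → ℝ}
  {u : ℝ → UnitAddTorus (Fin 3) → EuclideanSpace ℝ (Fin 3)} {ϑ : ℝ → UnitAddTorus (Fin 3) → ℝ}

/-- The time set `[0,T₁)` has unique derivatives. [folklore] -/
theorem uniqueDiffOn_Ico_time (T₁ : ℝ) : UniqueDiffOn ℝ (Ico (0 : ℝ) T₁) := uniqueDiffOn_Ico 0 T₁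

namespace IsClassicalEulerSolution

/-- The slices `ρ t`, `ϑ t`, `u t` and their coordinates are `C¹` torus functions. [folklore] -/
theorem isContDiff_slices (h : IsClassicalEulerSolution eos T₁ ρ u ϑ) {t : ℝ} (ht : t ∈ Ico 0 T₁) :
    IsContDiff 1 (ρ t) ∧ IsContDiff 1 (ϑ t) ∧ IsContDiff 1 (u t) ∧
      ∀ i, IsContDiff 1 (fun y => u t y i) :=
  ⟨(h.smooth_density.isSmooth_slice ht).isContDiff (by simp),
    (h.smooth_temperature.isSmooth_slice ht).isContDiff (by simp),
    (h.smooth_velocity.isSmooth_slice ht).isContDiff (by simp),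
    fun i => ((h.smooth_velocity.apply i).isSmooth_slice ht).isContDiff (by simp)⟩

/-- **Continuity equation at a point**: `Dₜr + r divU = 0`. [cite: BrezinaFeireisl2018, (1.1)] -/
theorem massEq_pointData (h : IsClassicalEulerSolution eos T₁ ρ u ϑ) {t : ℝ} (ht : t ∈ Ico 0 T₁)
    (x : UnitAddTorus (Fin 3)) : (classicalPointData (Ico 0 T₁) ρ u ϑ t x).MassEq := by
  obtain ⟨hρ1, -, hu1, hui⟩ := h.isContDiff_slices ht
  have hm := h.mass t ht x
  rw [divergence_smul hρ1 hu1] at hm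
  unfold MassEq Dtr divU classicalPointData
  simp only
  simp_rw [gradient_apply hρ1, partialDeriv_apply_coord hu1]
  have : Torus.divergence (u t) x = ∑ i, partialDeriv i (u t) x i := by
    unfold Torus.divergence
    exact Finset.sum_congr rfl fun i _ => partialDeriv_apply_coord hu1 i x i
  rw [this] at hm
  linarith [hm, Finset.sum_congr rfl fun (i : Fin 3) (_ : i ∈ Finset.univ) =>
    mul_comm (partialDeriv i (ρ t) x) (u t x i)]

/-- The divergence of `ρ u` in coordinates: `div(ρu) = ∑ⱼ ∂ⱼ(ρ uⱼ)`. [folklore] -/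
theorem divergence_density_smul (t : ℝ) (x : UnitAddTorus (Fin 3)) :
    Torus.divergence (fun y => ρ t y • u t y) x = ∑ j, partialDeriv j (fun y => ρ t y * u t y j) x := by
  unfold Torus.divergence
  refine Finset.sum_congr rfl fun j _ => ?_
  have : (fun y => (ρ t y • u t y) j) = fun y => ρ t y * u t y j := by funext y; simp
  rw [this]

/-- **Momentum equation at a point in convective form**:
`r (∂ₜUᵢ + ∑ⱼ Uⱼ ∂ⱼUᵢ) + p_ρ ∂ᵢr + p_ϑ ∂ᵢΘ = 0`. [cite: BrezinaFeireisl2018, (1.1)–(1.2)] -/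
theorem momentumEq_pointData (h : IsClassicalEulerSolution eos T₁ ρ u ϑ) (hp : eos.IsGibbs)
    {t : ℝ} (ht : t ∈ Ico 0 T₁) (x : UnitAddTorus (Fin 3)) :
    (classicalPointData (Ico 0 T₁) ρ u ϑ t x).MomentumEq eos := by
  intro i
  have hS := uniqueDiffOn_Ico_time T₁
  obtain ⟨hρ1, hϑ1, hu1, hui⟩ := h.isContDiff_slices ht
  have hpos : ∀ y, (ρ t y, ϑ t y) ∈ Ioi (0 : ℝ) ×ˢ Ioi (0 : ℝ) := fun y =>
    ⟨h.density_pos t ht y, h.temperature_pos t ht y⟩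
  -- (A) time derivative of `ρ u`
  have hA : timeDerivWithin (Ico 0 T₁) (fun s y => ρ s y • u s y) t x i =
      ρ t x * timeDerivWithin (Ico 0 T₁) u t x i + timeDerivWithin (Ico 0 T₁) ρ t x * u t x i := by
    rw [timeDerivWithin_smul h.smooth_density h.smooth_velocity hS ht x]
    simp
  -- (B) the convective term
  have hρuj : ∀ j, IsContDiff 1 (fun y => ρ t y * u t y j) := fun j => ContDiff.mul hρ1 (hui j)
  have hF : ∀ j, IsContDiff 1 (fun y => (ρ t y * u t y j) • u t y) := fun j =>
    ContDiff.smul (hρuj j) hu1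
  have hB : (∑ j, partialDeriv j (fun y => (ρ t y * u t y j) • u t y) x) i =
      ρ t x * ∑ j, u t x j * partialDeriv j (fun y => u t y i) x +
        (∑ j, partialDeriv j (fun y => ρ t y * u t y j) x) * u t x i := by
    have e1 : (∑ j, partialDeriv j (fun y => (ρ t y * u t y j) • u t y) x) i =
        ∑ j, partialDeriv j (fun y => (ρ t y * u t y j) • u t y) x i := by
      simp [WithLp.ofLp_sum, Finset.sum_apply]
    rw [e1, Finset.mul_sum, Finset.sum_mul, ← Finset.sum_add_distrib]
    refine Finset.sum_congr rfl fun j _ => ?_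
    rw [← partialDeriv_apply_coord (hF j) j x i]
    have : (fun y => ((ρ t y * u t y j) • u t y) i) = fun y => (ρ t y * u t y j) * u t y i := by
      funext y; simp
    rw [this, partialDeriv_mul (hρuj j) (hui i)]
    ring
  -- (C) the pressure gradient
  have hpc : IsContDiff 1 (fun y => eos.p (ρ t y) (ϑ t y)) :=
    isContDiff_comp₂ hp.1 le_rfl hρ1 hϑ1 hpos
  have hC : Torus.gradient (fun y => eos.p (ρ t y) (ϑ t y)) x i =
      deriv (fun r => eos.p r (ϑ t x)) (ρ t x) * Torus.gradient (ρ t) x i +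
        deriv (fun θ => eos.p (ρ t x) θ) (ϑ t x) * Torus.gradient (ϑ t) x i := by
    rw [gradient_apply hpc, gradient_apply hρ1, gradient_apply hϑ1,
      partialDeriv_comp₂ hp.1 isOpen_quadrant le_rfl hρ1 hϑ1 x (hpos x) i]
  -- the conservative momentum equation, coordinate `i`, and the continuity equation
  have hmom := congrArg (fun v : EuclideanSpace ℝ (Fin 3) => v i) (h.momentum t ht x)
  simp only [PiLp.add_apply, PiLp.zero_apply] at hmom
  rw [hA, hB, hC] at hmom
  have hmass := h.mass t ht x
  rw [divergence_density_smul (ρ := ρ) (u := u) t x] at hmass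
  simp only [gp, pρ, pϑ, classicalPointData]
  linear_combination hmom - (u t x i) * hmass

/-- **Temperature (internal energy) equation at a point**:
`e_ϑ(r,Θ) DₜΘ = -(p(r,Θ) - r² e_ρ(r,Θ)) divU / r`, obtained from the total energy balance (1.3)
by subtracting the continuity equation times `½|U|² + e + r e_ρ` and the convective momentum
equation paired with `U`. [cite: BrezinaFeireisl2018, (1.1)–(1.3)] -/
theorem temperatureEq_pointData (h : IsClassicalEulerSolution eos T₁ ρ u ϑ) (hp : eos.IsGibbs)
    {t : ℝ} (ht : t ∈ Ico 0 T₁) (x : UnitAddTorus (Fin 3)) :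
    (classicalPointData (Ico 0 T₁) ρ u ϑ t x).TemperatureEq eos := by
  have hS := uniqueDiffOn_Ico_time T₁
  obtain ⟨hρ1, hϑ1, hu1, hui⟩ := h.isContDiff_slices ht
  have hpos : ∀ y, (ρ t y, ϑ t y) ∈ Ioi (0 : ℝ) ×ˢ Ioi (0 : ℝ) := fun y =>
    ⟨h.density_pos t ht y, h.temperature_pos t ht y⟩
  have hr : 0 < ρ t x := h.density_pos t ht x
  -- regularity of the composite slices
  have hec : IsContDiff 1 (fun y => eos.e (ρ t y) (ϑ t y)) := isContDiff_comp₂ hp.2.1 le_rfl hρ1 hϑ1 hpos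
  have hpc : IsContDiff 1 (fun y => eos.p (ρ t y) (ϑ t y)) := isContDiff_comp₂ hp.1 le_rfl hρ1 hϑ1 hpos
  have hkin : IsContDiff 1 (fun y => ‖u t y‖ ^ 2 / 2) := by
    have : (fun y => ‖u t y‖ ^ 2 / 2) = fun y => (1 / 2 : ℝ) • ‖u t y‖ ^ 2 := by
      funext y; simp [div_eq_inv_mul]
    rw [this]; exact (hu1.norm_sq ℝ).const_smul _
  have hε : IsContDiff 1 (fun y => ‖u t y‖ ^ 2 / 2 + eos.e (ρ t y) (ϑ t y)) := hkin.add hec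
  have hρε : IsContDiff 1 (fun y => ρ t y * (‖u t y‖ ^ 2 / 2 + eos.e (ρ t y) (ϑ t y))) :=
    ContDiff.mul hρ1 hε
  have hf : IsContDiff 1 (fun y => ρ t y * (‖u t y‖ ^ 2 / 2 + eos.e (ρ t y) (ϑ t y)) +
      eos.p (ρ t y) (ϑ t y)) := hρε.add hpc
  -- (T) the time derivative of the total energy
  have hd_ρ := h.smooth_density.hasDerivWithinAt_slice ht x
  have hd_u := h.smooth_velocity.hasDerivWithinAt_slice ht x
  have hd_ϑ := h.smooth_temperature.hasDerivWithinAt_slice ht x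
  have hd_kin : HasDerivWithinAt (fun τ => ‖u τ x‖ ^ 2 / 2)
      (∑ k, u t x k * timeDerivWithin (Ico 0 T₁) u t x k) (Ico 0 T₁) t := by
    have h1 := (hd_u.inner ℝ hd_u).div_const 2
    have heq : (fun τ => ⟪u τ x, u τ x⟫_ℝ / 2) = fun τ => ‖u τ x‖ ^ 2 / 2 := by
      funext τ; rw [real_inner_self_eq_norm_sq]
    rw [heq] at h1
    refine h1.congr_deriv ?_
    rw [real_inner_comm, ← two_mul, mul_div_cancel_left₀ _ two_ne_zero, PiLp.inner_apply]
    exact Finset.sum_congr rfl fun k _ => by simp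
  have hd_e : HasDerivWithinAt (fun τ => eos.e (ρ τ x) (ϑ τ x))
      (deriv (fun r => eos.e r (ϑ t x)) (ρ t x) * timeDerivWithin (Ico 0 T₁) ρ t x +
        deriv (fun θ => eos.e (ρ t x) θ) (ϑ t x) * timeDerivWithin (Ico 0 T₁) ϑ t x) (Ico 0 T₁) t :=
    hasDerivWithinAt_comp₂ hp.2.1 isOpen_quadrant le_rfl (hpos x) hd_ρ hd_ϑ
  have hT : timeDerivWithin (Ico 0 T₁)
      (fun s y => ρ s y * (‖u s y‖ ^ 2 / 2 + eos.e (ρ s y) (ϑ s y))) t x =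
      timeDerivWithin (Ico 0 T₁) ρ t x * (‖u t x‖ ^ 2 / 2 + eos.e (ρ t x) (ϑ t x)) +
        ρ t x * ((∑ k, u t x k * timeDerivWithin (Ico 0 T₁) u t x k) +
          (deriv (fun r => eos.e r (ϑ t x)) (ρ t x) * timeDerivWithin (Ico 0 T₁) ρ t x +
            deriv (fun θ => eos.e (ρ t x) θ) (ϑ t x) * timeDerivWithin (Ico 0 T₁) ϑ t x)) :=
    (hd_ρ.fun_mul (hd_kin.add hd_e)).derivWithin (hS t ht)
  -- (X) spatial derivatives
  have hXε : ∀ i, partialDeriv i (fun y => ‖u t y‖ ^ 2 / 2 + eos.e (ρ t y) (ϑ t y)) x =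
      (∑ k, u t x k * partialDeriv i (fun y => u t y k) x) +
        (deriv (fun r => eos.e r (ϑ t x)) (ρ t x) * partialDeriv i (ρ t) x +
          deriv (fun θ => eos.e (ρ t x) θ) (ϑ t x) * partialDeriv i (ϑ t) x) := fun i => by
    rw [partialDeriv_add_apply hkin hec, partialDeriv_half_norm_sq hu1,
      partialDeriv_comp₂ hp.2.1 isOpen_quadrant le_rfl hρ1 hϑ1 x (hpos x) i]
  have hXf : ∀ i, partialDeriv i (fun y => ρ t y * (‖u t y‖ ^ 2 / 2 + eos.e (ρ t y) (ϑ t y)) +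
      eos.p (ρ t y) (ϑ t y)) x =
      (ρ t x * ((∑ k, u t x k * partialDeriv i (fun y => u t y k) x) +
        (deriv (fun r => eos.e r (ϑ t x)) (ρ t x) * partialDeriv i (ρ t) x +
          deriv (fun θ => eos.e (ρ t x) θ) (ϑ t x) * partialDeriv i (ϑ t) x)) +
        partialDeriv i (ρ t) x * (‖u t x‖ ^ 2 / 2 + eos.e (ρ t x) (ϑ t x))) +
      (deriv (fun r => eos.p r (ϑ t x)) (ρ t x) * partialDeriv i (ρ t) x +
        deriv (fun θ => eos.p (ρ t x) θ) (ϑ t x) * partialDeriv i (ϑ t) x) := fun i => by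
    rw [partialDeriv_add_apply hρε hpc, partialDeriv_mul hρ1 hε, hXε i,
      partialDeriv_comp₂ hp.1 isOpen_quadrant le_rfl hρ1 hϑ1 x (hpos x) i]
  have hdivu : Torus.divergence (u t) x = ∑ i, partialDeriv i (fun y => u t y i) x := rfl
  -- the energy balance, expanded
  have hEn := h.energy t ht x
  rw [hT, divergence_smul hf hu1 x, hdivu] at hEn
  simp only [hXf] at hEn
  -- continuity and momentum equations at the point
  have hMa := h.massEq_pointData ht x
  have hMo := h.momentumEq_pointData hp ht x
  unfold MassEq Dtr divU at hMa
  unfold MomentumEq at hMo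
  have hMo0 := hMo 0
  have hMo1 := hMo 1
  have hMo2 := hMo 2
  simp only [gp, pρ, pϑ, classicalPointData, gradient_apply hρ1, gradient_apply hϑ1,
    Fin.sum_univ_three] at hMa hMo0 hMo1 hMo2
  simp only [Fin.sum_univ_three] at hEn
  -- the goal
  unfold TemperatureEq
  simp only [DtΘ, divU, classicalPointData, gradient_apply hϑ1, Fin.sum_univ_three]
  rw [eq_div_iff hr.ne']
  linear_combination hEn -
    (‖u t x‖ ^ 2 / 2 + eos.e (ρ t x) (ϑ t x) + ρ t x * deriv (fun r => eos.e r (ϑ t x)) (ρ t x)) * hMa -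
    u t x 0 * hMo0 - u t x 1 * hMo1 - u t x 2 * hMo2

end IsClassicalEulerSolution

end CompressibleEuler

end Literature.Analysis.FluidPDE
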